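import Literature.MathematicalPhysics.QuantumLattice.HubbardScaleReportCT
import Summits.HubbardSuperconductivity.HubbardSuperconductivity.Theorems.AposterioriCapRgSeededBrokenRegimeBoseFermiPinnedQuadraticFormKernelFour
import Summits.HubbardSuperconductivity.HubbardSuperconductivity.Theorems.AposterioriCapRgSeededBrokenRegimeBoseFermiPinnedCooperKeptKernelAnomalous
import Summits.HubbardSuperconductivity.HubbardSuperconductivity.Theorems.AposterioriCapRgSeededBrokenRegimeBoseFermiPinnedLegKernelNormSingle
import Summits.HubbardSuperconductivity.HubbardSuperconductivity.Theorems.AposterioriCapRgSeededBrokenRegimeBoseFermiPinnedCooperKeptKernelTwo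

/-!
# What the report's remainder norm charges of the effective action itself
# (stubs N5 `stub_anomalousKernelFloor`, N6 `stub_quadraticMismatchFloor` of line `seed-strength-flow`,
# crux `SeededBrokenRegimeBoseFermiPinned` = stmt-HubbardSuperconductivity-14047)

The conclusion of the crux (and the hypothesis of the consumer crux `AposterioriOrderCriterionR` = stmt-13884) is
typed over the countertermed report `hubbardScaleReportCT` (D1″, `HubbardScaleReportCT.lean`): a realised tuple `p`
carries `η^K(q) = scaledRemainderNormCT L M β U μ h K Λ₀ q ≤ p.remainderNorm` for SOME hidden normal form `q`, where
`η^K(q) = Σ_m Λ₀^{-(2m-3)} ‖R̃_m‖_{wt_m}` normes the remainder `R = 𝒢 − 𝒬(q) − 𝒦(𝒢)` of the effective action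
`𝒢 = hubbardEffectiveActionCT L M β U μ h K Λ₀` w.r.t. the quadratic quasiparticle form `𝒬(q)` and the kept `B₁g`
Cooper term `𝒦(𝒢)` (monomials `ψ⁺↑ψ⁺↓ψ⁻↓ψ⁻↑` among below-scale legs).

This file proves the two `q`-INDEPENDENT lower bounds of `η^K(q)` by kernels of `𝒢` itself:

* `stub_anomalousKernelFloor` (N5): at every SAME-CHARGE quartic configuration `X` (the anomalous monomials
  `ψ⁺ψ⁺ψ⁺ψ⁺` / `ψ⁻ψ⁻ψ⁻ψ⁻`, i.e. the blocks `B̄B̄` / `BB` of the transverse pair-mode exchange, which `cooperKeptCT`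
  does not keep — `stub_cooperKeptKernelAnomalous` — and to which `𝒬(q)` does not contribute —
  `stub_quadraticFormKernelFour`), `Λ₀⁻⁵ · ε³ · ∏ᵢ wt^E_q(Xᵢ) · |𝒢̃₄(X)| ≤ η^K(q)` with the energy leg weights and
  the marginal scaling `Λ₀⁻⁵` of degree `4` (`ε = (βL²)⁻¹`, `𝒢̃₄ = weightedKernel ε 𝒢 4`);
* `stub_quadraticMismatchFloor` (N6): at every quadratic configuration,
  `Λ₀⁻¹ · ε · wt^S(X₀)wt^S(X₁) · |(𝒢 − 𝒬(q))~₂(X)| ≤ η^K(q)` with the shell leg weights and the relevant scaling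
  `Λ₀⁻¹` (`𝒦(𝒢)` has no quadratic kernel — `stub_cooperKeptKernelTwo`): a dishonest normal form is charged at the
  relevant rate.

Read one way these are the kernel-checkable half of the standing disprover's `∀ etaStar` floor (Disproof.lean §9,
FLOOR_c2.md: the anomalous block is marginal and `h`-uniform, so `inf_D η > 0` at every certified point); read the
other way they are the estimates a consumer of a certified small `η` extracts on the non-kept anomalous block and on the
two-point mismatch.  Corollaries `exists_anomalousKernel_le_of_isRealisedAtCT` / `exists_quadraticMismatch_le_of_isRealisedAtCT`
state them for realised tuples.  No model content beyond the definitions; sources: Salmhofer, CMP 194 (1998) §4.1 (the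
leg-weighted `L¹–L^∞` norm), the report's own definition request D1″ (route AposterioriCapRg).
-/

set_option linter.dupNamespace false -- `Summit.<S>.<S>` doubles the summit name (tree convention)

namespace Summit.HubbardSuperconductivity.HubbardSuperconductivity.Theorems.AposterioriCapRgSeededBrokenRegimeBoseFermiPinned

open Literature.MathematicalPhysics.QuantumLattice Literature.Probability.LatticeModels GrassmannAlgebra

namespace AnomalousKernelFloor

/-! ### Kernel identities: what the remainder keeps of `𝒢` -/

/-- **The anomalous quartic kernel of the remainder is that of `𝒢`**: at a same-charge configuration `X`,
`kernel (𝒢 − 𝒬(q) − 𝒦(𝒢)) 4 X = kernel 𝒢 4 X` (N1: `𝒬(q)` has no quartic kernel; N2: `𝒦(𝒢)` has none at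
same-charge configurations). [folklore] -/
theorem kernel_four_remainderOfCT_eq (L M : ℕ) {Np : ℕ} [NeZero L] (β U μ h : ℝ) (K : TrigPolyC4v) (Λ₀ : ℝ)
    (q : HubbardNormalForm L Np) (X : Fin 4 → HubbardFieldIdx L M) (c : Fin 2) (hX : ∀ i, (X i).2 = c) :
    kernel ℂ (remainderOfCT L M β U μ h K Λ₀ q) 4 X = kernel ℂ (hubbardEffectiveActionCT L M β U μ h K Λ₀) 4 X := by
  rw [kernel_def, kernel_def, remainderOfCT, map_sub, map_sub, map_sub, map_sub,
    QuadraticFormKernelFour.constPart_iterDeriv_four_normalFormQuadratic,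
    CooperKeptKernelAnomalous.constPart_iterDeriv_four_cooperKeptCT L M β μ K Λ₀ _ X c hX, sub_zero, sub_zero]

/-- … and so is its weighted (Salmhofer) kernel. [folklore] -/
theorem weightedKernel_four_remainderOfCT_eq (L M : ℕ) {Np : ℕ} [NeZero L] (β U μ h : ℝ) (K : TrigPolyC4v)
    (Λ₀ ε : ℝ) (q : HubbardNormalForm L Np) (X : Fin 4 → HubbardFieldIdx L M) (c : Fin 2) (hX : ∀ i, (X i).2 = c) :
    weightedKernel ε (remainderOfCT L M β U μ h K Λ₀ q) 4 X =
      weightedKernel ε (hubbardEffectiveActionCT L M β U μ h K Λ₀) 4 X := by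
  rw [weightedKernel_def, weightedKernel_def, kernel_four_remainderOfCT_eq L M β U μ h K Λ₀ q X c hX]

/-- **The quadratic kernel of the remainder is that of the mismatch `𝒢 − 𝒬(q)`** (N4: `𝒦(𝒢)` has no quadratic
kernel). [folklore] -/
theorem kernel_two_remainderOfCT_eq (L M : ℕ) {Np : ℕ} [NeZero L] (β U μ h : ℝ) (K : TrigPolyC4v) (Λ₀ : ℝ)
    (q : HubbardNormalForm L Np) (X : Fin 2 → HubbardFieldIdx L M) :
    kernel ℂ (remainderOfCT L M β U μ h K Λ₀ q) 2 X =
      kernel ℂ (hubbardEffectiveActionCT L M β U μ h K Λ₀ - normalFormQuadratic L M β q) 2 X := by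
  rw [kernel_def, kernel_def, remainderOfCT, map_sub (iterDeriv ℂ X), map_sub (constPart ℂ),
    CooperKeptKernelTwo.constPart_iterDeriv_two_cooperKeptCT, sub_zero]

/-- … and so is its weighted kernel. [folklore] -/
theorem weightedKernel_two_remainderOfCT_eq (L M : ℕ) {Np : ℕ} [NeZero L] (β U μ h : ℝ) (K : TrigPolyC4v)
    (Λ₀ ε : ℝ) (q : HubbardNormalForm L Np) (X : Fin 2 → HubbardFieldIdx L M) :
    weightedKernel ε (remainderOfCT L M β U μ h K Λ₀ q) 2 X =
      weightedKernel ε (hubbardEffectiveActionCT L M β U μ h K Λ₀ - normalFormQuadratic L M β q) 2 X := by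
  rw [weightedKernel_def, weightedKernel_def, kernel_two_remainderOfCT_eq]

/-! ### One degree of the scaled remainder norm -/

/-- The field labels number at least `4` as soon as one exists (`|Γ| = |FreqMomentum| · 2 · 2`). [folklore] -/
theorem four_le_card_hubbardFieldIdx (L M : ℕ) [NeZero L] (X₀ : HubbardFieldIdx L M) :
    4 ≤ Fintype.card (HubbardFieldIdx L M) := by
  have hpos : 0 < Fintype.card (FreqMomentum L M) := Fintype.card_pos_iff.2 ⟨X₀.1.1⟩
  rw [Fintype.card_prod, Fintype.card_prod, Fintype.card_fin]
  omega

/-- Every degree of the scaled remainder norm is a nonnegative summand (`β > 0`, `Λ₀ ≥ 0`). [folklore] -/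
theorem scaledRemainderNormCT_summand_nonneg (L M : ℕ) {Np : ℕ} [NeZero L] {β Λ₀ : ℝ} (hβ : 0 < β) (hΛ : 0 ≤ Λ₀)
    (U μ h : ℝ) (K : TrigPolyC4v) (q : HubbardNormalForm L Np) (m : ℕ) :
    0 ≤ Λ₀ ^ (-(2 * (m : ℤ) - 3)) *
      legKernelNorm (if m = 2 then shellLegWeightCT L M β μ K Λ₀ else energyLegWeightCT L M β μ h K Λ₀ q)
        (1 / (β * (L : ℝ) ^ 2)) m
        (weightedKernel (1 / (β * (L : ℝ) ^ 2)) (remainderOfCT L M β U μ h K Λ₀ q) m) := by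
  refine mul_nonneg (zpow_nonneg hΛ _) (legKernelNorm_nonneg ?_ ?_ _ _)
  · intro Y
    split_ifs
    · exact shellLegWeightCT_nonneg L M β μ K Λ₀ Y
    · exact energyLegWeightCT_nonneg L M β μ h K Λ₀ q Y
  · have hL : (0 : ℝ) < (L : ℝ) := by exact_mod_cast Nat.pos_of_ne_zero (NeZero.ne L)
    positivity

/-- **One degree bounds the scaled remainder norm from below**: for `m ≤ |Γ|`,
`Λ₀^{-(2m-3)} ‖R̃_m‖_{wt_m} ≤ η^K(q)`. [folklore] -/
theorem summand_le_scaledRemainderNormCT (L M : ℕ) {Np : ℕ} [NeZero L] {β Λ₀ : ℝ} (hβ : 0 < β) (hΛ : 0 ≤ Λ₀)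
    (U μ h : ℝ) (K : TrigPolyC4v) (q : HubbardNormalForm L Np) {m : ℕ}
    (hm : m ≤ Fintype.card (HubbardFieldIdx L M)) :
    Λ₀ ^ (-(2 * (m : ℤ) - 3)) *
        legKernelNorm (if m = 2 then shellLegWeightCT L M β μ K Λ₀ else energyLegWeightCT L M β μ h K Λ₀ q)
          (1 / (β * (L : ℝ) ^ 2)) m
          (weightedKernel (1 / (β * (L : ℝ) ^ 2)) (remainderOfCT L M β U μ h K Λ₀ q) m) ≤
      scaledRemainderNormCT L M β U μ h K Λ₀ q := by
  rw [scaledRemainderNormCT]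
  exact Finset.single_le_sum
    (f := fun m : ℕ => Λ₀ ^ (-(2 * (m : ℤ) - 3)) *
      legKernelNorm (if m = 2 then shellLegWeightCT L M β μ K Λ₀ else energyLegWeightCT L M β μ h K Λ₀ q)
        (1 / (β * (L : ℝ) ^ 2)) m
        (weightedKernel (1 / (β * (L : ℝ) ^ 2)) (remainderOfCT L M β U μ h K Λ₀ q) m))
    (fun m _ => scaledRemainderNormCT_summand_nonneg L M hβ hΛ U μ h K q m)
    (Finset.mem_range.2 (Nat.lt_succ_of_le hm))

end AnomalousKernelFloor

open AnomalousKernelFloor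

/-- **N5 (`AnomalousKernelFloor`) of line `seed-strength-flow`**: for EVERY normal form `q`, the CT scaled remainder
norm dominates the anomalous quartic kernel of the effective action itself, energy-leg-weighted, at the marginal
scaling of degree `4`: `Λ₀⁻⁵ · ε³ · ∏ᵢ wt^E_q(Xᵢ) · |𝒢̃₄(X)| ≤ η^K(q)` at every same-charge configuration `X`
(`ε = (βL²)⁻¹`) — the anomalous blocks `B̄B̄`, `BB` are neither part of `𝒬(q)` nor kept by `cooperKeptCT`, and one
weighted term is dominated by Salmhofer's leg-weighted `L¹–L^∞` norm. [folklore] -/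
theorem stub_anomalousKernelFloor :
    ∀ (L M Np : ℕ) [NeZero L] (β U μ h : ℝ) (K : TrigPolyC4v) (Λ₀ : ℝ) (q : HubbardNormalForm L Np)
      (X : Fin 4 → HubbardFieldIdx L M) (c : Fin 2), 0 < β → 0 < Λ₀ → (∀ i, (X i).2 = c) →
        Λ₀ ^ (-(5 : ℤ)) * ((1 / (β * (L : ℝ) ^ 2)) ^ 3 *
          ((∏ i, energyLegWeightCT L M β μ h K Λ₀ q (X i)) *
            ‖weightedKernel (1 / (β * (L : ℝ) ^ 2)) (hubbardEffectiveActionCT L M β U μ h K Λ₀) 4 X‖)) ≤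
          scaledRemainderNormCT L M β U μ h K Λ₀ q := by
  intro L M Np _ β U μ h K Λ₀ q X c hβ hΛ hX
  have hL : (0 : ℝ) < (L : ℝ) := by exact_mod_cast Nat.pos_of_ne_zero (NeZero.ne L)
  have hε : (0 : ℝ) ≤ 1 / (β * (L : ℝ) ^ 2) := by positivity
  -- the degree-4 summand of `η^K(q)` dominates the single weighted term at `X` (N3) …
  have h4 := summand_le_scaledRemainderNormCT L M hβ hΛ.le U μ h K q (four_le_card_hubbardFieldIdx L M (X 0))
  have hsingle := LegKernelNormSingle.single_le_legKernelNorm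
    (fun Y => energyLegWeightCT_nonneg L M β μ h K Λ₀ q Y) hε 3
    (weightedKernel (1 / (β * (L : ℝ) ^ 2)) (remainderOfCT L M β U μ h K Λ₀ q) 4) X
  -- … whose kernel is the anomalous kernel of `𝒢` itself (N1, N2)
  rw [weightedKernel_four_remainderOfCT_eq L M β U μ h K Λ₀ _ q X c hX] at hsingle
  have hif : (if (4 : ℕ) = 2 then shellLegWeightCT L M β μ K Λ₀ else energyLegWeightCT L M β μ h K Λ₀ q) =
      energyLegWeightCT L M β μ h K Λ₀ q := if_neg (by decide)
  rw [hif] at h4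
  have hexp : (-(2 * ((4 : ℕ) : ℤ) - 3)) = -(5 : ℤ) := by norm_num
  rw [hexp] at h4
  exact (mul_le_mul_of_nonneg_left hsingle (zpow_nonneg hΛ.le _)).trans h4

/-- **N6 (`QuadraticMismatchFloor`) of line `seed-strength-flow`**: for EVERY normal form `q`, the CT scaled remainder
norm dominates the quadratic mismatch `𝒢 − 𝒬(q)`, shell-weighted, at the relevant scaling `Λ₀⁻¹`:
`Λ₀⁻¹ · ε · wt^S(X₀)wt^S(X₁) · |(𝒢 − 𝒬(q))~₂(X)| ≤ η^K(q)` (`𝒦(𝒢)` has no quadratic kernel). [folklore] -/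
theorem stub_quadraticMismatchFloor :
    ∀ (L M Np : ℕ) [NeZero L] (β U μ h : ℝ) (K : TrigPolyC4v) (Λ₀ : ℝ) (q : HubbardNormalForm L Np)
      (X : Fin 2 → HubbardFieldIdx L M), 0 < β → 0 < Λ₀ →
        Λ₀ ^ (-(1 : ℤ)) * ((1 / (β * (L : ℝ) ^ 2)) *
          ((∏ i, shellLegWeightCT L M β μ K Λ₀ (X i)) *
            ‖weightedKernel (1 / (β * (L : ℝ) ^ 2))
                (hubbardEffectiveActionCT L M β U μ h K Λ₀ - normalFormQuadratic L M β q) 2 X‖)) ≤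
          scaledRemainderNormCT L M β U μ h K Λ₀ q := by
  intro L M Np _ β U μ h K Λ₀ q X hβ hΛ
  have hL : (0 : ℝ) < (L : ℝ) := by exact_mod_cast Nat.pos_of_ne_zero (NeZero.ne L)
  have hε : (0 : ℝ) ≤ 1 / (β * (L : ℝ) ^ 2) := by positivity
  have h2 := summand_le_scaledRemainderNormCT L M hβ hΛ.le U μ h K q
    ((show 2 ≤ 4 by norm_num).trans (four_le_card_hubbardFieldIdx L M (X 0)))
  have hsingle := LegKernelNormSingle.single_le_legKernelNorm
    (fun Y => shellLegWeightCT_nonneg L M β μ K Λ₀ Y) hε 1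
    (weightedKernel (1 / (β * (L : ℝ) ^ 2)) (remainderOfCT L M β U μ h K Λ₀ q) 2) X
  rw [weightedKernel_two_remainderOfCT_eq, pow_one] at hsingle
  have hif : (if (2 : ℕ) = 2 then shellLegWeightCT L M β μ K Λ₀ else energyLegWeightCT L M β μ h K Λ₀ q) =
      shellLegWeightCT L M β μ K Λ₀ := if_pos rfl
  rw [hif] at h2
  have hexp : (-(2 * ((2 : ℕ) : ℤ) - 3)) = -(1 : ℤ) := by norm_num
  rw [hexp] at h2
  exact (mul_le_mul_of_nonneg_left hsingle (zpow_nonneg hΛ.le _)).trans h2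

/-! ### Corollaries for realised tuples -/

/-- **A realised tuple's remainder dominates the anomalous quartic kernel of `𝒢`**: if `p` is CT-realised, then for
the (some) normal form realising it, `Λ₀⁻⁵ ε³ ∏ wt^E_q(Xᵢ) |𝒢̃₄(X)| ≤ p.remainderNorm` at every same-charge `X` —
the entry point of a remainder FLOOR (Disproof.lean `reportFloor_of_realisedFloor`) and of the consumer's control of
the non-kept anomalous block. [folklore] -/
theorem exists_anomalousKernel_le_of_isRealisedAtCT {L M Np : ℕ} [NeZero L] {β U μ h Λ₀ : ℝ} {K : TrigPolyC4v}
    {nodal : Finset (Fin Np)} {p : HubbardScaleData.Parameters Np} (hΛ : 0 < Λ₀)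
    (hp : IsRealisedAtCT L M β U μ h K Λ₀ Np nodal p) :
    ∃ q : HubbardNormalForm L Np, (∀ i, GapConditionCT L μ K h Λ₀ q i (p.gap i)) ∧
      ∀ (X : Fin 4 → HubbardFieldIdx L M) (c : Fin 2), (∀ i, (X i).2 = c) →
        Λ₀ ^ (-(5 : ℤ)) * ((1 / (β * (L : ℝ) ^ 2)) ^ 3 *
          ((∏ i, energyLegWeightCT L M β μ h K Λ₀ q (X i)) *
            ‖weightedKernel (1 / (β * (L : ℝ) ^ 2)) (hubbardEffectiveActionCT L M β U μ h K Λ₀) 4 X‖)) ≤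
          p.remainderNorm := by
  obtain ⟨hβ, q, -, hgap, -, -, -, -, -, hη⟩ := hp
  exact ⟨q, hgap, fun X c hX => (stub_anomalousKernelFloor L M Np β U μ h K Λ₀ q X c hβ hΛ hX).trans hη⟩

/-- **A realised tuple's remainder dominates the quadratic mismatch of its normal form**: if `p` is CT-realised by
`q`, then `Λ₀⁻¹ ε wt^S(X₀)wt^S(X₁) |(𝒢 − 𝒬(q))~₂(X)| ≤ p.remainderNorm` — a normal form far from the true two-point
data of `𝒢` is charged at the relevant rate `Λ₀⁻¹`. [folklore] -/
theorem exists_quadraticMismatch_le_of_isRealisedAtCT {L M Np : ℕ} [NeZero L] {β U μ h Λ₀ : ℝ} {K : TrigPolyC4v}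
    {nodal : Finset (Fin Np)} {p : HubbardScaleData.Parameters Np} (hΛ : 0 < Λ₀)
    (hp : IsRealisedAtCT L M β U μ h K Λ₀ Np nodal p) :
    ∃ q : HubbardNormalForm L Np, (∀ i, GapConditionCT L μ K h Λ₀ q i (p.gap i)) ∧
      (∀ i ∈ nodal, NodalConditionCT L μ K h Λ₀ q i p.fermiVelocity p.gapVelocity) ∧
      ∀ X : Fin 2 → HubbardFieldIdx L M,
        Λ₀ ^ (-(1 : ℤ)) * ((1 / (β * (L : ℝ) ^ 2)) *
          ((∏ i, shellLegWeightCT L M β μ K Λ₀ (X i)) *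
            ‖weightedKernel (1 / (β * (L : ℝ) ^ 2))
                (hubbardEffectiveActionCT L M β U μ h K Λ₀ - normalFormQuadratic L M β q) 2 X‖)) ≤
          p.remainderNorm := by
  obtain ⟨hβ, q, -, hgap, -, hnod, -, -, -, hη⟩ := hp
  exact ⟨q, hgap, hnod, fun X => (stub_quadraticMismatchFloor L M Np β U μ h K Λ₀ q X hβ hΛ).trans hη⟩

end Summit.HubbardSuperconductivity.HubbardSuperconductivity.Theorems.AposterioriCapRgSeededBrokenRegimeBoseFermiPinned
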